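import Literature.AlgebraicGeometry.Frobenioids.Categories
import Mathlib.Topology.Algebra.Group.Basic
import Mathlib.Tactic.Group
import HarnessLib

/-!
# Slimness of a topological group from a slim NORMAL subgroup with trivial centraliser

Topic `Literature/GroupTheory` (abc-iut cell, campaign-L residual «J2»; the "extension step" of
[AbsTopIII] Lemma 4.3 as used in the proof of Prop. 4.2 (i), kurims p. 106, for
`Π_{[X/Aut X]} ⊇ Π_X`: the profinite fundamental group of the quotient orbicurve is an extension of the
finite group `Aut X` by the slim group `Π_X` with faithful outer action).  S. Mochizuki, *Topics in
absolute anabelian geometry III*, [AbsTopI] §0 p. 8 for the word: a topological group is *slim* if the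
centraliser of every open subgroup is trivial (the tree's `IsSlimGroup`, [FrdI] §0 p. 13).

PROOF-ONLY file (no definition, no named fact):

* `IsSlimGroup.of_normal_of_centralizer_eq_bot` — **if `H ⊴ G` is a normal subgroup of a topological
  group, slim for the subspace topology, with `C_G(H) = 1`, then `G` is slim.**  No compactness, no
  index or openness hypothesis on `H`.  Proof: for `U ⊆ G` open and `g ∈ Z_G(U)`, and `h ∈ H`, the
  commutator `[g, h] ∈ H` centralises the open subgroup `(U ∩ H) ∩ h (U ∩ H) h⁻¹` of `H`, hence is
  trivial by slimness of `H`; so `g ∈ C_G(H) = 1`.  (Since a slim `H` is centre-free, `C_G(H) = 1` is the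
  same as faithfulness of the outer action `G/H → Out(H)`; compare the tree's ascent
  `isSlimGroup_of_isOpen_slim_of_forall_finite_normal_eq_bot`, which needs `H` open, `G` compact and
  "no nontrivial finite normal subgroup", and `arith_slim_of_geom_slim_of_gal_slim`, which needs the
  QUOTIENT slim.)
* `isSlimGroup_iff_centralizer_eq_bot_of_isOpen_normal` — for `H` open, normal and slim: `G` slim iff
  `C_G(H) = 1` (the converse direction is the definition of slimness).

Use: with `H = Λ̂ ⊴ N(Λ̄)^` (abc-iut `FreeNormalSubgroupCompletionCentralizer.lean`) it yields the
slimness of the profinite completion of the normaliser of a free Fuchsian group.  Classical group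
theory; OUR kernel check; nothing here bears on [IUTchIII] Cor. 3.12 or takes a side.
-/

namespace Literature.GroupTheory

open Literature.AlgebraicGeometry.Frobenioids (IsSlimGroup)

universe u

/-! ### The abstract extension step: slim normal subgroup with trivial centraliser -/

section SlimExtension

variable {G : Type u} [Group G] [TopologicalSpace G] [IsTopologicalGroup G]

/-- **Slimness extends along a slim normal subgroup with trivial centraliser** (the "extension step"
of [AbsTopIII] Lemma 4.3 for `Π_{[X/Aut X]} ⊇ Π_X`): if `H ⊴ G` is normal, slim for the subspace
topology, and `C_G(H) = 1`, then `G` is slim.  Proof: for `g ∈ Z_G(U)`, `U` open, and `h ∈ H`, the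
commutator `[g, h] ∈ H` centralises the open subgroup `(U ∩ H) ∩ h(U ∩ H)h⁻¹` of `H`, so `[g, h] = 1`
by slimness of `H`; thus `g ∈ C_G(H) = 1`.  No compactness or index hypothesis (compare the tree's
`isSlimGroup_of_isOpen_slim_of_forall_finite_normal_eq_bot`, which needs `U` open, `G` compact and
"no finite normal subgroup"). [cite: MochizukiAbsTopIII2015, Proposition 4.2 (i) proof p.106] -/
theorem _root_.Literature.AlgebraicGeometry.Frobenioids.IsSlimGroup.of_normal_of_centralizer_eq_bot (H : Subgroup G) [H.Normal]
    (hH : IsSlimGroup H) (hC : Subgroup.centralizer (H : Set G) = ⊥) : IsSlimGroup G := by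
  refine ⟨fun U hU => ?_⟩
  rw [eq_bot_iff]
  intro g hg
  rw [Subgroup.mem_centralizer_iff] at hg
  -- `g` centralises `H`
  have hgH : g ∈ Subgroup.centralizer (H : Set G) := by
    rw [Subgroup.mem_centralizer_iff]
    intro h hh
    -- the commutator `c = g h g⁻¹ h⁻¹ ∈ H`
    have hc : g * h * g⁻¹ * h⁻¹ ∈ H := H.mul_mem (‹H.Normal›.conj_mem h hh g) (H.inv_mem hh)
    -- the open subgroup `V = U ∩ H` of `H` and `W = V ∩ h V h⁻¹`
    let x : H := ⟨h, hh⟩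
    let V : Subgroup H := U.comap H.subtype
    have hV : IsOpen (V : Set H) := hU.preimage continuous_subtype_val
    let W : Subgroup H := V ⊓ V.comap (MulAut.conj x⁻¹).toMonoidHom
    have hW : IsOpen (W : Set H) := by
      change IsOpen ((V : Set H) ∩ (fun n => (MulAut.conj x⁻¹).toMonoidHom n) ⁻¹' (V : Set H))
      refine hV.inter (hV.preimage ?_)
      show Continuous fun n : H => (MulAut.conj x⁻¹) n
      simp only [MulAut.conj_apply]
      fun_prop
    -- `c` centralises `W`
    have hcW : (⟨g * h * g⁻¹ * h⁻¹, hc⟩ : H) ∈ Subgroup.centralizer (W : Set H) := by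
      rw [Subgroup.mem_centralizer_iff]
      rintro ⟨n, hn⟩ ⟨hnV, hnV'⟩
      -- `n ∈ U` and `h⁻¹ n h ∈ U`
      have hnU : n ∈ U := hnV
      have hnU' : h⁻¹ * n * h ∈ U := by
        have h1 : ((MulAut.conj x⁻¹).toMonoidHom ⟨n, hn⟩ : H) ∈ V := hnV'
        have h2 : ((MulAut.conj x⁻¹ ⟨n, hn⟩ : H) : G) ∈ U := h1
        simpa [MulAut.conj_apply, x] using h2
      apply Subtype.ext
      change n * (g * h * g⁻¹ * h⁻¹) = g * h * g⁻¹ * h⁻¹ * n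
      have e1 : n * g = g * n := hg n hnU
      have e2 : h⁻¹ * n * h * g = g * (h⁻¹ * n * h) := hg _ hnU'
      have e2' : g⁻¹ * (h⁻¹ * n * h) = (h⁻¹ * n * h) * g⁻¹ := by
        calc g⁻¹ * (h⁻¹ * n * h) = g⁻¹ * ((h⁻¹ * n * h) * g) * g⁻¹ := by group
          _ = g⁻¹ * (g * (h⁻¹ * n * h)) * g⁻¹ := by rw [e2]
          _ = (h⁻¹ * n * h) * g⁻¹ := by group
      symm
      calc g * h * g⁻¹ * h⁻¹ * n = g * h * (g⁻¹ * (h⁻¹ * n * h)) * h⁻¹ := by group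
        _ = g * h * ((h⁻¹ * n * h) * g⁻¹) * h⁻¹ := by rw [e2']
        _ = (g * n) * h * g⁻¹ * h⁻¹ := by group
        _ = (n * g) * h * g⁻¹ * h⁻¹ := by rw [e1]
        _ = n * (g * h * g⁻¹ * h⁻¹) := by group
    rw [hH.centralizer_eq_bot W hW, Subgroup.mem_bot] at hcW
    have : g * h * g⁻¹ * h⁻¹ = 1 := congrArg Subtype.val hcW
    calc h * g = (g * h * g⁻¹ * h⁻¹)⁻¹ * (g * h) := by group
      _ = g * h := by rw [this, inv_one, one_mul]
  rw [hC] at hgH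
  exact hgH

/-- Conversely (and trivially), in a slim group the centraliser of an OPEN subgroup is trivial; so for
`H ⊴ G` open, normal and slim: `G` is slim iff `C_G(H) = 1`.
[cite: MochizukiAbsTopIII2015, Proposition 4.2 (i) proof p.106] -/
theorem isSlimGroup_iff_centralizer_eq_bot_of_isOpen_normal (H : Subgroup G) [H.Normal]
    (hHo : IsOpen (H : Set G)) (hH : IsSlimGroup H) :
    IsSlimGroup G ↔ Subgroup.centralizer (H : Set G) = ⊥ :=
  ⟨fun hG => hG.centralizer_eq_bot H hHo, IsSlimGroup.of_normal_of_centralizer_eq_bot H hH⟩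

end SlimExtension

end Literature.GroupTheory
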